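import Summits.BirchSwinnertonDyer.Rank1Residual.Additive.CyclotomicTowerSignedSelmerDual
import HarnessLib

/-!
# The `η`-average `A_η = Σ_{δ ∈ Δ} η(δ)·conj_δ` on `H¹(K₀K_∞, E[p^∞])` and on Kobayashi's
# `Sel^ε(E/K_∞)`: `Γ_K`-equivariance, `η`-eigen image, and SURJECTIVITY onto `Sel^ε(E/K_∞)^η`
# (cell `bsd-potss`, seat `bsd-potss-k8q-c5` g0; K8 crux (R2±) `NoFiniteSubmoduleSigned`, items
# stmt-BirchSwinnertonDyer-19117 / 19222 / 19233 — FILE 1 of 2 of the discharge of the reading flag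
# `KO18-eta-summand`; FILE 2 = `CyclotomicTowerSignedSelmerEtaSummand.lean`)

HONEST FRAMING (cell `bsd-potss`, run/shared/lean/pub/bsd-potss/; FULL-BSD rank ≤ 1 programme,
tranche 1b): INFRASTRUCTURE — two transparent definitions (representatives `deltaRep` of
`Δ = ker κ / U_∞`, the `η`-average `etaAverage`), two bookkeeping instances (finite index /
`Fintype` of `Δ`), and THEOREMS; no named Literature fact, no `Prop` definition, no hypothesis
structure, no `sorry`, axioms standard. NOTHING of Kobayashi's or Kitajima–Otsuki's theorems is
asserted; nothing is booked; no label / mark / count moves. The objects are cc-typer-6's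
`Γ_K`-internal tower objects (`CyclotomicTowerSignedSelmer*.lean`): `U_∞ = towerTopSubgroup κ K₀ =
ker κ ⊓ Gal(K̄/K₀)`, `Sel^ε(E/K_∞) = towerSignedSelmerInfty`, `Sel^ε(E/K_∞)^η =
towerSignedSelmerInftyEta`; the `η`-average itself is x1b's device (`SignedTwistSelmerInftyEta`, the
operator `A = Σ_q η(q̃) conj_{q̃}` used there inline for `K = ℚ`), here made a definition for general
`K` and studied as an operator.

## Source, verbatim (Kobayashi, Invent. Math. 152 (2003) §3 p. 5, §4 p. 8)

p. 5: "`G_∞ = Δ × Γ`, where `Δ ≅ ℤ/(p−1)ℤ` and `Γ ≅ ℤ_p`." p. 8: "For a `ℤ_p[Δ]`-module `M`, let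
`M^η` denote the `η`-component of `M`. If we denote `ε_η = (1/♯Δ) ∑_{τ∈Δ} η^{−1}(τ) τ`, `M^η` is
given by `ε_η M`."

## What (general data: `K`, `κ : ZpExtension K p`, `K₀/K` with `Gal(K̄/K₀)` normal, a character
## `η : Γ_K →* ℤˣ` trivial on `Gal(K̄/K₀)`; Kobayashi: `K = ℚ`, `K₀ = ℚ(μ_p)`, `η = ω^{(p−1)/2}`)

* §1 `Δ = ker κ / U_∞`: `♯Δ ∣ [Γ_K : Gal(K̄/K₀)]` (so `p ∤ ♯Δ` when `p ∤ [Γ_K : Gal(K̄/K₀)]`), finite;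
  representatives `deltaRep q ∈ ker κ`; classes agree iff representatives differ by `U_∞`.
* §2 `etaAverage W κ K₀ η = A_η = Σ_{q ∈ Δ} η(q̃)·conj_{q̃}` (`= ♯Δ·ε_η`; `η² = 1` so `η⁻¹ = η`):
  `U_∞` acts trivially on `H¹(U_∞, ·)` (`conjH1_of_mem`), so summands do not depend on the
  representative (`eta_zsmul_conjH1_eq_of_inv_mul_mem`); **`conj_g ∘ A_η = A_η ∘ conj_g` for every
  `g ∈ Γ_K`** (`g` permutes `Δ` by conjugation; `η(g q̃ g⁻¹) = η(q̃)`) — so `A_η` commutes with the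
  `Λ`-action through any `γ`; **`conj_σ (A_η t) = η(σ)·A_η t` for `σ ∈ ker κ`** (`σ` permutes `Δ` by
  translation); `A_η` preserves `Sel^ε(E/K_∞)` and lands in `Sel^ε(E/K_∞)^η`; **on an `η`-eigenclass
  `A_η = ♯Δ`**, hence **`A_η : Sel^ε(E/K_∞) → Sel^ε(E/K_∞)^η` is ONTO** for `p ∤ [Γ_K : Gal(K̄/K₀)]`
  (the classes are `p`-primary, (P) of cc-typer-6's FILE 3).

References: [Kobayashi2003] Def. 2.1 (p. 5), §3 p. 5, §4 p. 8; [GreenbergLNM1716] §1 p. 60, §5 p. 143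
(prime-to-`p` descent); [DokchitserDokchitserAnnals2010] Lemma 4.14 (proof: sums over coset
representatives are invariant).
-/

noncomputable section

open scoped Classical

universe u

namespace Summit.BirchSwinnertonDyer.Rank1Residual.Additive

open Literature.NumberTheory.EllipticCurves Literature.NumberTheory.GaloisRepresentations
  Literature.NumberTheory.EllipticCurves.IwasawaAlgebra Literature.NumberTheory.EllipticCurves.IwasawaDual
  Literature.NumberTheory.EllipticCurves.Kobayashi2003 ZpExtension


/-! ## §1 `Δ = ker κ / U_∞` and its representatives -/

section Delta

variable {K : Type u} [Field K] {p : ℕ} [Fact p.Prime] (κ : ZpExtension K p) (K₀ : Type u)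
  [Field K₀] [Algebra K K₀]

/-- A representative `q̃ ∈ ker κ` of `q ∈ Δ = ker κ / U_∞` (a choice, `Quotient.out`).
[cite: Kobayashi2003, §4 p. 8 (the sum over τ ∈ Δ)] -/
def deltaRep (q : κ.kerSubgroup ⧸ (towerTopSubgroup κ K₀).subgroupOf κ.kerSubgroup) :
    Field.absoluteGaloisGroup K :=
  ((Quotient.out q : κ.kerSubgroup) : Field.absoluteGaloisGroup K)

/-- Representatives lie in `ker κ`. [folklore] -/
theorem deltaRep_mem (q : κ.kerSubgroup ⧸ (towerTopSubgroup κ K₀).subgroupOf κ.kerSubgroup) :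
    deltaRep κ K₀ q ∈ κ.kerSubgroup :=
  (Quotient.out q).2

/-- The class of the representative is the class. [folklore] -/
theorem mk_deltaRep (q : κ.kerSubgroup ⧸ (towerTopSubgroup κ K₀).subgroupOf κ.kerSubgroup) :
    (QuotientGroup.mk (⟨deltaRep κ K₀ q, deltaRep_mem κ K₀ q⟩ : κ.kerSubgroup) :
      κ.kerSubgroup ⧸ (towerTopSubgroup κ K₀).subgroupOf κ.kerSubgroup) = q := by
  have h : (⟨deltaRep κ K₀ q, deltaRep_mem κ K₀ q⟩ : κ.kerSubgroup) = Quotient.out q := Subtype.ext rfl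
  rw [h]
  exact QuotientGroup.out_eq' q

/-- Two elements of `ker κ` with the same class in `Δ` differ by an element of `U_∞`:
`a⁻¹ * b ∈ U_∞`. [folklore] -/
theorem inv_mul_mem_towerTop_of_mk_eq {a b : Field.absoluteGaloisGroup K} (ha : a ∈ κ.kerSubgroup)
    (hb : b ∈ κ.kerSubgroup)
    (h : (QuotientGroup.mk (⟨a, ha⟩ : κ.kerSubgroup) :
        κ.kerSubgroup ⧸ (towerTopSubgroup κ K₀).subgroupOf κ.kerSubgroup) =
      QuotientGroup.mk (⟨b, hb⟩ : κ.kerSubgroup)) :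
    a⁻¹ * b ∈ towerTopSubgroup κ K₀ := by
  rw [QuotientGroup.eq, Subgroup.mem_subgroupOf] at h
  exact h

/-- Conversely, elements of `ker κ` differing by `U_∞` have the same class. [folklore] -/
theorem mk_eq_of_inv_mul_mem_towerTop {a b : Field.absoluteGaloisGroup K} (ha : a ∈ κ.kerSubgroup)
    (hb : b ∈ κ.kerSubgroup) (h : a⁻¹ * b ∈ towerTopSubgroup κ K₀) :
    (QuotientGroup.mk (⟨a, ha⟩ : κ.kerSubgroup) :
        κ.kerSubgroup ⧸ (towerTopSubgroup κ K₀).subgroupOf κ.kerSubgroup) =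
      QuotientGroup.mk (⟨b, hb⟩ : κ.kerSubgroup) := by
  rw [QuotientGroup.eq, Subgroup.mem_subgroupOf]
  exact h

variable [(galRange (K := K) K₀).Normal]

/-- `[ker κ : U_∞] ∣ [Γ_K : Gal(K̄/K₀)]` (`U_∞ = ker κ ⊓ Gal(K̄/K₀)`, `Gal(K̄/K₀)` normal) — for
`K = ℚ`, `K₀ = ℚ(μ_p)`: `♯Δ ∣ p − 1`. [cite: Kobayashi2003, §3 p. 5 (Δ ≅ ℤ/(p−1)ℤ)] -/
theorem relIndex_towerTopSubgroup_kerSubgroup_dvd :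
    (towerTopSubgroup κ K₀).relIndex κ.kerSubgroup ∣ (galRange (K := K) K₀).index := by
  rw [show towerTopSubgroup κ K₀ = κ.kerSubgroup ⊓ galRange (K := K) K₀ from rfl,
    Subgroup.inf_relIndex_left]
  exact Subgroup.relIndex_dvd_index_of_normal _ _

variable [NumberField K] [NumberField K₀]

/-- `U_∞` has finite index in `ker κ` (it divides the finite `[Γ_K : Gal(K̄/K₀)]`). [folklore] -/
instance finiteIndex_towerTopSubgroup_subgroupOf_kerSubgroup :
    ((towerTopSubgroup κ K₀).subgroupOf κ.kerSubgroup).FiniteIndex :=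
  ⟨fun h0 ↦ Subgroup.FiniteIndex.index_ne_zero (H := galRange (K := K) K₀)
    (Nat.eq_zero_of_zero_dvd ((show (towerTopSubgroup κ K₀).relIndex κ.kerSubgroup = 0 from h0) ▸
      relIndex_towerTopSubgroup_kerSubgroup_dvd κ K₀))⟩

/-- `Δ = ker κ / U_∞` is a finite type (noncomputably). [folklore] -/
instance fintypeKerSubgroupModTowerTop :
    Fintype (κ.kerSubgroup ⧸ (towerTopSubgroup κ K₀).subgroupOf κ.kerSubgroup) :=
  Fintype.ofFinite _

/-- `♯Δ ∣ [Γ_K : Gal(K̄/K₀)]` in `Fintype.card` form. [cite: Kobayashi2003, §3 p. 5] -/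
theorem card_kerSubgroupModTowerTop_dvd :
    Fintype.card (κ.kerSubgroup ⧸ (towerTopSubgroup κ K₀).subgroupOf κ.kerSubgroup) ∣
      (galRange (K := K) K₀).index := by
  rw [← Nat.card_eq_fintype_card]
  exact relIndex_towerTopSubgroup_kerSubgroup_dvd κ K₀

end Delta

/-! ## §2 The `η`-average `A_η = Σ_{δ ∈ Δ} η(δ)·conj_δ` on `H¹(K₀K_∞, E[p^∞])` -/

section Average

variable {K : Type u} [Field K] [NumberField K] (W : WeierstrassCurve K) {p : ℕ} [Fact p.Prime]
  (κ : ZpExtension K p) (K₀ : Type u) [Field K₀] [NumberField K₀] [Algebra K K₀]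
  [(galRange (K := K) K₀).Normal] (η : Field.absoluteGaloisGroup K →* ℤˣ)

/-- **The `η`-average `A_η = Σ_{q ∈ Δ} η(q̃)·conj_{q̃}`** on `H¹(K₀·K_∞, E[p^∞])`
(`= ♯Δ · ε_η`, Kobayashi p. 8, for `η` of order `≤ 2`, `η⁻¹ = η`), summed over the chosen
representatives `q̃ ∈ ker κ` of `Δ = ker κ / U_∞`; an additive endomorphism.
[cite: Kobayashi2003, §4 p. 8 (M^η = ε_η M, ε_η = (1/♯Δ) Σ η⁻¹(τ) τ)] -/
def etaAverage :
    W.subgroupH1 p (towerTopSubgroup κ K₀) →+ W.subgroupH1 p (towerTopSubgroup κ K₀) :=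
  AddMonoidHom.mk'
    (fun t ↦ ∑ q : κ.kerSubgroup ⧸ (towerTopSubgroup κ K₀).subgroupOf κ.kerSubgroup,
      ((η (deltaRep κ K₀ q) : ℤˣ) : ℤ) • W.conjH1 p (towerTopSubgroup κ K₀) (deltaRep κ K₀ q) t)
    fun a b ↦ by
      rw [← Finset.sum_add_distrib]
      exact Finset.sum_congr rfl fun q _ ↦ by rw [map_add, zsmul_add]

/-- Unfolding `etaAverage` (definitional). [cite: Kobayashi2003, §4 p. 8] -/
theorem etaAverage_apply (t : W.subgroupH1 p (towerTopSubgroup κ K₀)) :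
    etaAverage W κ K₀ η t =
      ∑ q : κ.kerSubgroup ⧸ (towerTopSubgroup κ K₀).subgroupOf κ.kerSubgroup,
        ((η (deltaRep κ K₀ q) : ℤˣ) : ℤ) • W.conjH1 p (towerTopSubgroup κ K₀) (deltaRep κ K₀ q) t :=
  rfl

/-- `u • u • x = x` for `u ∈ ℤˣ = {±1}`. [folklore] -/
private theorem units_zsmul_units_zsmul {A : Type*} [AddCommGroup A] (u : ℤˣ) (x : A) :
    ((u : ℤ) • (u : ℤ) • x) = x := by
  rw [smul_smul, ← Units.val_mul, Int.units_mul_self, Units.val_one, one_zsmul]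

omit [NumberField K] [NumberField K₀] in
/-- **`U_∞` acts trivially, so the summands do not depend on the representative**: if
`a⁻¹ b ∈ U_∞` and `η` is trivial on `Gal(K̄/K₀) ⊇ U_∞` then `η(a)·conj_a t = η(b)·conj_b t` on
`H¹(K₀K_∞, E[p^∞])` (`conj_b = conj_a ∘ conj_{a⁻¹b}`, `conjH1_of_mem`). [cite: Kobayashi2003, §4 p. 8] -/
theorem eta_zsmul_conjH1_eq_of_inv_mul_mem (hηK : ∀ σ ∈ galRange (K := K) K₀, η σ = 1)
    {a b : Field.absoluteGaloisGroup K} (h : a⁻¹ * b ∈ towerTopSubgroup κ K₀)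
    (t : W.subgroupH1 p (towerTopSubgroup κ K₀)) :
    ((η a : ℤˣ) : ℤ) • W.conjH1 p (towerTopSubgroup κ K₀) a t =
      ((η b : ℤˣ) : ℤ) • W.conjH1 p (towerTopSubgroup κ K₀) b t := by
  have hb : b = a * (a⁻¹ * b) := by group
  have hη : η b = η a := by
    rw [hb, map_mul, hηK _ ((mem_towerTopSubgroup_iff κ K₀ _).mp h).2, mul_one]
  conv_rhs => rw [hη, hb, W.conjH1_mul_holds p (towerTopSubgroup κ K₀), AddMonoidHom.comp_apply,
    W.conjH1_of_mem_holds p (towerTopSubgroup κ K₀) h, AddMonoidHom.id_apply]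

/-- **`A_η` commutes with `conj_g` for EVERY `g ∈ Γ_K`**: `conj_g (A_η t) = A_η (conj_g t)`.
Conjugation by `g` permutes `Δ = ker κ / U_∞` (both normal in `Γ_K`), `conj_g conj_{q̃} =
conj_{g q̃ g⁻¹} conj_g`, `η(g q̃ g⁻¹) = η(q̃)` (`ℤˣ` is commutative), and `g q̃ g⁻¹` is the
representative of its class up to `U_∞`, which acts trivially. So `Λ = ℤ_p[[Γ]]` (through any
`γ`) commutes with `ε_η`. [cite: Kobayashi2003, §4 p. 8 (M^η is a Λ-submodule)]
[cite: DokchitserDokchitserAnnals2010, Lemma 4.14 (proof)] -/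
theorem conjH1_etaAverage (hηK : ∀ σ ∈ galRange (K := K) K₀, η σ = 1)
    (g : Field.absoluteGaloisGroup K) (t : W.subgroupH1 p (towerTopSubgroup κ K₀)) :
    W.conjH1 p (towerTopSubgroup κ K₀) g (etaAverage W κ K₀ η t) =
      etaAverage W κ K₀ η (W.conjH1 p (towerTopSubgroup κ K₀) g t) := by
  set Q := κ.kerSubgroup ⧸ (towerTopSubgroup κ K₀).subgroupOf κ.kerSubgroup
  -- conjugation by `g` on representatives
  have hmem : ∀ q : Q, g * deltaRep κ K₀ q * g⁻¹ ∈ κ.kerSubgroup := fun q ↦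
    κ.kerSubgroup_normal.conj_mem _ (deltaRep_mem κ K₀ q) g
  let f : Q → Q := fun q ↦ QuotientGroup.mk (⟨g * deltaRep κ K₀ q * g⁻¹, hmem q⟩ : κ.kerSubgroup)
  have hf : Function.Injective f := by
    intro q₁ q₂ h12
    have h := inv_mul_mem_towerTop_of_mk_eq κ K₀ (hmem q₁) (hmem q₂) h12
    have h' : (deltaRep κ K₀ q₁)⁻¹ * deltaRep κ K₀ q₂ =
        g⁻¹ * ((g * deltaRep κ K₀ q₁ * g⁻¹)⁻¹ * (g * deltaRep κ K₀ q₂ * g⁻¹)) * g⁻¹⁻¹ := by group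
    have hmemU : (deltaRep κ K₀ q₁)⁻¹ * deltaRep κ K₀ q₂ ∈ towerTopSubgroup κ K₀ := by
      rw [h']
      exact (normal_towerTopSubgroup κ K₀).conj_mem _ h g⁻¹
    rw [← mk_deltaRep κ K₀ q₁, ← mk_deltaRep κ K₀ q₂]
    exact mk_eq_of_inv_mul_mem_towerTop κ K₀ _ _ hmemU
  let π : Q ≃ Q := Equiv.ofBijective f (Finite.injective_iff_bijective.mp hf)
  have hπ : ∀ q : Q, (g * deltaRep κ K₀ q * g⁻¹)⁻¹ * deltaRep κ K₀ (π q) ∈ towerTopSubgroup κ K₀ :=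
    fun q ↦ inv_mul_mem_towerTop_of_mk_eq κ K₀ (hmem q) (deltaRep_mem κ K₀ (π q))
      (by rw [mk_deltaRep]; rfl)
  rw [etaAverage_apply, etaAverage_apply, map_sum,
    ← Equiv.sum_comp π (fun q ↦ ((η (deltaRep κ K₀ q) : ℤˣ) : ℤ) •
      W.conjH1 p (towerTopSubgroup κ K₀) (deltaRep κ K₀ q) (W.conjH1 p (towerTopSubgroup κ K₀) g t))]
  refine Finset.sum_congr rfl fun q _ ↦ ?_
  rw [map_zsmul, ← AddMonoidHom.comp_apply, ← W.conjH1_mul_holds p (towerTopSubgroup κ K₀),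
    ← eta_zsmul_conjH1_eq_of_inv_mul_mem W κ K₀ η hηK (hπ q), ← AddMonoidHom.comp_apply,
    ← W.conjH1_mul_holds p (towerTopSubgroup κ K₀), inv_mul_cancel_right, map_mul, map_mul, map_inv,
    mul_inv_cancel_comm]

/-- **On `ker κ` the average is `η`-EIGEN**: for `σ ∈ ker κ = Gal(K̄/K_∞^κ)`,
`conj_σ (A_η t) = η(σ)·A_η t` (`σ` permutes `Δ` by translation; `η(q̃) = η(σ)·η(σq̃)` as
`η(σ)² = 1`). [cite: Kobayashi2003, §4 p. 8 (ε_η M = M^η)] -/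
theorem conjH1_etaAverage_of_mem_kerSubgroup (hηK : ∀ σ ∈ galRange (K := K) K₀, η σ = 1)
    {σ : Field.absoluteGaloisGroup K} (hσ : σ ∈ κ.kerSubgroup)
    (t : W.subgroupH1 p (towerTopSubgroup κ K₀)) :
    W.conjH1 p (towerTopSubgroup κ K₀) σ (etaAverage W κ K₀ η t) =
      ((η σ : ℤˣ) : ℤ) • etaAverage W κ K₀ η t := by
  set Q := κ.kerSubgroup ⧸ (towerTopSubgroup κ K₀).subgroupOf κ.kerSubgroup
  have hmem : ∀ q : Q, σ * deltaRep κ K₀ q ∈ κ.kerSubgroup := fun q ↦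
    κ.kerSubgroup.mul_mem hσ (deltaRep_mem κ K₀ q)
  let f : Q → Q := fun q ↦ QuotientGroup.mk (⟨σ * deltaRep κ K₀ q, hmem q⟩ : κ.kerSubgroup)
  have hf : Function.Injective f := by
    intro q₁ q₂ h12
    have h := inv_mul_mem_towerTop_of_mk_eq κ K₀ (hmem q₁) (hmem q₂) h12
    have h' : (deltaRep κ K₀ q₁)⁻¹ * deltaRep κ K₀ q₂ =
        (σ * deltaRep κ K₀ q₁)⁻¹ * (σ * deltaRep κ K₀ q₂) := by group
    rw [← mk_deltaRep κ K₀ q₁, ← mk_deltaRep κ K₀ q₂]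
    exact mk_eq_of_inv_mul_mem_towerTop κ K₀ _ _ (h' ▸ h)
  let π : Q ≃ Q := Equiv.ofBijective f (Finite.injective_iff_bijective.mp hf)
  have hπ : ∀ q : Q, (σ * deltaRep κ K₀ q)⁻¹ * deltaRep κ K₀ (π q) ∈ towerTopSubgroup κ K₀ :=
    fun q ↦ inv_mul_mem_towerTop_of_mk_eq κ K₀ (hmem q) (deltaRep_mem κ K₀ (π q))
      (by rw [mk_deltaRep]; rfl)
  have hs : (((η σ : ℤˣ) : ℤ) • ∑ q : Q, ((η (deltaRep κ K₀ q) : ℤˣ) : ℤ) •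
        W.conjH1 p (towerTopSubgroup κ K₀) (deltaRep κ K₀ q) t) =
      ∑ q : Q, ((η σ : ℤˣ) : ℤ) • (((η (deltaRep κ K₀ q) : ℤˣ) : ℤ) •
        W.conjH1 p (towerTopSubgroup κ K₀) (deltaRep κ K₀ q) t) :=
    map_sum (zsmulAddGroupHom (α := W.subgroupH1 p (towerTopSubgroup κ K₀)) ((η σ : ℤˣ) : ℤ)) _ _
  rw [etaAverage_apply, map_sum, hs,
    ← Equiv.sum_comp π (fun q ↦ ((η σ : ℤˣ) : ℤ) • (((η (deltaRep κ K₀ q) : ℤˣ) : ℤ) •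
      W.conjH1 p (towerTopSubgroup κ K₀) (deltaRep κ K₀ q) t))]
  refine Finset.sum_congr rfl fun q _ ↦ ?_
  rw [map_zsmul, ← AddMonoidHom.comp_apply, ← W.conjH1_mul_holds p (towerTopSubgroup κ K₀),
    ← eta_zsmul_conjH1_eq_of_inv_mul_mem W κ K₀ η hηK (hπ q), map_mul, Units.val_mul, mul_smul,
    units_zsmul_units_zsmul]

/-- `A_η` preserves `Sel^ε(E/K_∞)` (every `conj_{q̃}` does). [cite: Kobayashi2003, Def. 2.1 (p. 5), §4 p. 8] -/
theorem etaAverage_mem_towerSignedSelmerInfty (E : Type u) [Field E] [Algebra K E] (ε : ℤˣ)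
    {t : W.subgroupH1 p (towerTopSubgroup κ K₀)} (ht : t ∈ towerSignedSelmerInfty W κ K₀ E ε) :
    etaAverage W κ K₀ η t ∈ towerSignedSelmerInfty W κ K₀ E ε := by
  rw [etaAverage_apply]
  exact AddSubgroup.sum_mem _ fun q _ ↦ AddSubgroup.zsmul_mem _
    (conjH1_mem_towerSignedSelmerInfty W κ K₀ E ε _ ht) _

/-- **`A_η` maps `Sel^ε(E/K_∞)` into `Sel^ε(E/K_∞)^η`** (`ε_η M ⊆ M^η`).
[cite: Kobayashi2003, §4 p. 8 (M^η = ε_η M)] -/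
theorem etaAverage_mem_towerSignedSelmerInftyEta (E : Type u) [Field E] [Algebra K E] (ε : ℤˣ)
    (hηK : ∀ σ ∈ galRange (K := K) K₀, η σ = 1)
    {t : W.subgroupH1 p (towerTopSubgroup κ K₀)} (ht : t ∈ towerSignedSelmerInfty W κ K₀ E ε) :
    etaAverage W κ K₀ η t ∈ towerSignedSelmerInftyEta W κ K₀ E η ε :=
  ⟨etaAverage_mem_towerSignedSelmerInfty W κ K₀ η E ε ht,
    fun _ hσ ↦ conjH1_etaAverage_of_mem_kerSubgroup W κ K₀ η hηK hσ t⟩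

/-- **On an `η`-eigenclass `A_η` is multiplication by `♯Δ`** (`ε_η` is the identity on `M^η`):
if `conj_σ t = η(σ)·t` for all `σ ∈ ker κ` then `A_η t = ♯Δ · t`. [cite: Kobayashi2003, §4 p. 8] -/
theorem etaAverage_eq_card_nsmul_of_eigen {t : W.subgroupH1 p (towerTopSubgroup κ K₀)}
    (ht : ∀ σ ∈ κ.kerSubgroup,
      W.conjH1 p (towerTopSubgroup κ K₀) σ t = ((η σ : ℤˣ) : ℤ) • t) :
    etaAverage W κ K₀ η t =
      Fintype.card (κ.kerSubgroup ⧸ (towerTopSubgroup κ K₀).subgroupOf κ.kerSubgroup) • t := by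
  rw [etaAverage_apply]
  refine (Finset.sum_congr rfl fun q _ ↦ ?_ : _ =
    ∑ _q : κ.kerSubgroup ⧸ (towerTopSubgroup κ K₀).subgroupOf κ.kerSubgroup, t).trans ?_
  · rw [ht _ (deltaRep_mem κ K₀ q), units_zsmul_units_zsmul]
  · rw [Finset.sum_const, Finset.card_univ]

/-- If `pʲ x = 0` and `d` is prime to `p` then `x = u • d • x` for some `u : ℕ`
(`d` is invertible modulo `p^j`). [folklore] -/
theorem exists_nsmul_nsmul_eq_self_of_coprime {A : Type*} [AddCommGroup A] {x : A} {j d : ℕ}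
    (hx : p ^ j • x = 0) (hd : d.Coprime p) : ∃ u : ℕ, u • d • x = x := by
  have hp : p.Prime := Fact.out
  obtain ⟨u, -, hu⟩ := Nat.exists_mul_mod_eq_one_of_coprime (hd.pow_right (j + 1))
    (Nat.one_lt_pow (Nat.succ_ne_zero j) hp.one_lt)
  have hj1 : p ^ (j + 1) • x = 0 := by rw [pow_succ', mul_nsmul', hx, nsmul_zero]
  have h := Nat.div_add_mod (d * u) (p ^ (j + 1))
  rw [hu] at h
  refine ⟨u, ?_⟩
  calc u • d • x = (d * u) • x := by rw [mul_comm, mul_nsmul']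
    _ = (p ^ (j + 1) * (d * u / p ^ (j + 1)) + 1) • x := by rw [h]
    _ = x := by rw [add_nsmul, one_nsmul, mul_nsmul, hj1, nsmul_zero, zero_add]

/-- **`A_η : Sel^ε(E/K_∞) → Sel^ε(E/K_∞)^η` is ONTO** for `p ∤ [Γ_K : Gal(K̄/K₀)]`: an `η`-eigenclass
`s` (which is `p`-primary, (P)) equals `A_η (u • s)` with `u·♯Δ ≡ 1` modulo the order of `s`.
[cite: Kobayashi2003, §4 p. 8 (M^η = ε_η M)] [cite: GreenbergLNM1716, §5 p. 143] -/
theorem exists_etaAverage_eq (E : Type u) [Field E] [Algebra K E] (ε : ℤˣ)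
    (hcop : (galRange (K := K) K₀).index.Coprime p)
    {s : W.subgroupH1 p (towerTopSubgroup κ K₀)} (hs : s ∈ towerSignedSelmerInftyEta W κ K₀ E η ε) :
    ∃ t ∈ towerSignedSelmerInfty W κ K₀ E ε, etaAverage W κ K₀ η t = s := by
  obtain ⟨j, hj⟩ := exists_pow_smul_subgroupH1_towerTop_eq_zero W κ K₀ s
  obtain ⟨u, hu⟩ := exists_nsmul_nsmul_eq_self_of_coprime (p := p) hj
    (Nat.Coprime.coprime_dvd_left (card_kerSubgroupModTowerTop_dvd κ K₀) hcop)
  refine ⟨u • s, AddSubgroup.nsmul_mem _ hs.1 u, ?_⟩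
  rw [map_nsmul, etaAverage_eq_card_nsmul_of_eigen W κ K₀ η hs.2, hu]

end Average

end Summit.BirchSwinnertonDyer.Rank1Residual.Additive

end
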